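import Mathlib
import Summits.QuantumFields.BalabanUV.Beta.AnalyticWalkSum216RowResolvent

/-!
# [Balaban1988RG2Cluster] p. 13 «The operator G̃₃(x) has the same properties as G̃₂, especially it can be expanded into a
# generalized random walk expansion» — THEOREM B: route A.3′ END-TO-END over the co-owner's fully decorated ω-expansion,
# «(T2)-shape ⇐ (T3) + R_A» as ONE kernel statement with EVERY hypothesis explicit, and its joint satisfiability
# (cell topic `Summits/QuantumFields/BalabanUV/Beta`; row-D4 rider (ρ3), both halves joined; sibling of
# `AnalyticWalkSum216RowResolvent`)

HONEST FRAMING (cell rule).  Discharging `BetaPertH` makes Bałaban's UV stability UNCONDITIONAL — a real constructive-QFT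
result; NOT the continuum limit, NOT the Clay problem.  This module discharges NOTHING of `BetaPertH`.  [folklore]
bookkeeping: THEOREM A of the sibling (`rowData_resolvent` ∕ `wrs_resolvent_sub` ∕ `woodbury_resolvent`) instantiated with
the co-owner road's `UnitLatticeOmegaRowData.rowData_decFamilyΩ` ∕ `termSum_decFamilyΩ_one` (unit `b2b-balaban-beta-d4-p3`
gen 4) for the x-scaled sandwiched pieces `K_ω^{(x)} = x·QG_ωP`, the level-`x` budgets and `Rem₂`-smallness being derived
from the level-`X` budgets (sibling §3).  The hypothesis list of `rowData_resolventΩ` IS the row's typed statement of what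
route A.3′ needs: (T3) = `hG`; R_A = `hKdom … hΦ`; A2 = `hL`; (ρ2)∕R25 = `hρX`.  Nothing of Bałaban's operators is
instantiated ((T3) and NODE O.2 untouched); NO class change on any GAPS row; NOT summit progress.  Unit
`b2b-balaban-beta-an4-g38` (owner of `BINDER-OWNERS.md` row D4); `GAPS.md` C-an4-91.

CITATION HEADER (lean-in-tree rule).  [II] = T. Bałaban, *Renormalization group approach to lattice gauge field theories.
II. Cluster expansions*, Commun. Math. Phys. **116**, 1–22 (1988) [Balaban1988RG2Cluster], p. 13 [PDF 13] (render
`HOME/b2b-balaban-ref1/pages/1988-cmp116-rg-II-cluster/…-p013-x2.png`, READ AS IMAGE by this lineage), verbatim: *"The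
operator G̃₃(x) has the same properties as G̃₂, especially it can be expanded into a generalized random walk expansion."*;
p. 16 [PDF 16] (2.16): *"|R₁(b, b′)| ≦ (O(1)e^{−1∕3δ₀M} + O(α₀ + α₁))exp(−½δ₀|b₋ − b′₋|)"*.  Nothing printed is asserted;
the Woodbury route is the cell's (route A.3′ of `OUTLINE-D4-NODE-A.md`), not the paper's.

WHAT IS CERTIFIED HERE (kernel, sorry-free; [folklore]).
§1 **`rowData_resolventΩ`** — for every frozen decoration `‖τ(Δ)‖ ≤ e^{κ₁}` and free cell `Δ₀`, the recombined family
   «decorated G-pieces − x·(decorated G-pieces)·(P·(fully decorated ω-expansion of (1 + x·QGP)⁻¹)·Q)·(decorated G-pieces)»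
   is ROW DATA on `‖σ‖ < e^{κ₁}` at rate `κ` with the x-UNIFORM, VOLUME-FREE constant
   `ρ_G + X·(ρ_G·(c_P·(e^{κ₁Pk}NC_L(1 − C_L((2N/M)XK₁ + XΦ))⁻¹·c_Q))·ρ_G)`; **`wrs_resolventΩ_sub`** — the (2.16)-shape END
   that the (T1) reduction (`AnalyticWalkSum216`) consumes; **`termSum_resolventΩ_one`** — at `s ≡ 1` the family SUMS to
   `((Σ_ωG_ω)⁻¹ + P(x·1)Q)⁻¹`, the G̃₃(x) = (G₂⁻¹ + xQ̂*Q̂)⁻¹ shape (no separate `hRem`: sibling `wrs_Rem₂_le`).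
§2 **Joint satisfiability** of the ENTIRE hypothesis list of §1 (one site, one block, one piece `G = 1`, `P = Q = 1`,
   `x = X = 1`, `h ≡ 1`, `L = ½·1`, `d ≡ 0`, all budgets `0`): `Witness.rowData_inhabited`, `Witness.termSum_one_inhabited`.
NOT CLAIMED.  Any expansion of Bałaban's G̃₂ (hypothesis `hG` = (T3)); the (3.186) projection layer (rider (ρ1));
k-uniformity of any constant (NODE O.2).  NOT summit progress.
PRIOR ART IN THE TREE (searched 2026-08-20): the sibling and its imports; nothing re-derived.
-/

namespace Summit.QuantumFields.BalabanUV.Beta.AnalyticWalkSum216RowResolventOmega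

open Metric Set
open Literature.MathematicalPhysics.QuantumFieldTheory.Balaban1983to89
open B13PerturbativeStep (WRS WeightHyp wrs)
open Summit.QuantumFields.BalabanUV.Beta.AnalyticWalkSum216 (termSum majSum)
open Summit.QuantumFields.BalabanUV.Beta.AnalyticWalkSum216Recomb (recombTerm recombMaj RIdx)
open Summit.QuantumFields.BalabanUV.Beta.AnalyticWalkSum216RowData (RowData)
open Summit.QuantumFields.BalabanUV.Beta.AnalyticWalkSum216RowResolvent
open Summit.QuantumFields.BalabanUV.Beta.UnitLatticeWalkInversion (Hd Pj Ptot)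
open Summit.QuantumFields.BalabanUV.Beta.UnitLatticeOmegaTerms
open Summit.QuantumFields.BalabanUV.Beta.UnitLatticeOmegaTube (listLen listLen_nonneg decΩ)
open Summit.QuantumFields.BalabanUV.Beta.UnitLatticeOmegaPaths
open Summit.QuantumFields.BalabanUV.Beta.UnitLatticeOmegaRowData

noncomputable section

variable {Y : Type*} [Fintype Y] [DecidableEq Y] {κ : ℝ} {d : Y → Y → ℝ}

/-! ## §1 THEOREM B — END-TO-END over the co-owner's ω-expansion: «(T2)-shape ⇐ (T3) + R_A» -/

section TheoremB

variable {B Ω Δ : Type*} [Fintype B] [Fintype Ω] [DecidableEq Ω] [DecidableEq Δ]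

/-- **THEOREM B — ROUTE A.3′ END-TO-END IN ABSTRACT KERNEL FORM.**  HYPOTHESES, grouped: (T3) `hG` — the localised,
decoration-weighted bound for the pieces of G̃₂'s expansion (constant `ρ_G`, volume-free); the sandwich `P`, `Q`
localised (`c_P`, `c_Q`); the resolvent parameter `‖x‖ ≤ X`; R_A — VERBATIM the hypotheses of the co-owner's
`UnitLatticeOmegaRowData.rowData_decFamilyΩ` for the UNSCALED unit-lattice pieces `Q·G_ω·P` (block-locality on `Dω`,
near families, partition `h` with supports `E` of diameter `≤ D`, `|h| ≤ 1`, Lipschitz `1/M`, overlap `N`, cells with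
packing `Pk` at radius `Rr ≥ r + D, r + Df`, threads and credits, the budgets `K₁`, `Φ` at rate `κ + κ₁Pk/r`) together
with a local-inverse family `L` (for the level-`x` near kernels; only its x-UNIFORM budget `C_L` enters — the co-owner's
A2) and the LEVEL-`X` SMALLNESS `C_L·((2N/M)·XK₁ + XΦ) < 1` (rider (ρ2), R25).  CONCLUSION: for every frozen decoration
`‖τ(Δ)‖ ≤ e^{κ₁}` and free cell `Δ₀`, the recombined family `G − x·G·(P·Ω^{(x)}·Q)·G` — decorated G-pieces, the
sandwiched fully decorated ω-expansion of `(1 + x·QGP)⁻¹` — is ROW DATA on `‖σ‖ < e^{κ₁}` at rate `κ` with the x-UNIFORM,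
VOLUME-FREE constant `ρ_G + X·(ρ_G·(c_P·(e^{κ₁Pk}NC_L(1 − C_L((2N/M)XK₁ + XΦ))⁻¹·c_Q))·ρ_G)`.
[cite: Balaban1988RG2Cluster, p.13 after (2.7)] -/
theorem rowData_resolventΩ [Nonempty Y] (hw : WeightHyp κ d) (hsymm : ∀ a b, d a b = d b a)
    (G : Ω → Matrix Y Y ℂ) (DG : Ω → Finset Δ) {κ₁ ρG : ℝ} (hκ₁ : 0 ≤ κ₁)
    (hG : ∀ i, ∑ j, (∑ ω, pieceMaj κ₁ G DG ω i j) * Real.exp (κ * d i j) ≤ ρG)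
    (P Q : Matrix Y Y ℂ) {cP cQ : ℝ} (hP : WRS κ d P cP) (hQ : WRS κ d Q cQ) {x : ℂ} {X : ℝ} (hx : ‖x‖ ≤ X)
    (Dω : Ω → Finset Y) (hKdom : ∀ ω k l, (Q * G ω * P) k l ≠ 0 → k ∈ Dω ω) (near : B → Finset Ω)
    (h : B → Y → ℝ) (E : B → Finset Y) (L : B → Matrix Y Y ℂ) (hsupp : ∀ b y, y ∉ E b → h b y = 0)
    (habs : ∀ b y, |h b y| ≤ 1) {M N C_L K₁ Φ r D Df Rr : ℝ} (hM : 0 < M)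
    (hLip : ∀ b y y', |h b y - h b y'| ≤ d y y' / M) (hN : ∀ y, ((Finset.univ.filter fun b => y ∈ E b).card : ℝ) ≤ N)
    (hC : 0 ≤ C_L) (hr : 0 < r) (hRD : r + D ≤ Rr) (hRf : r + Df ≤ Rr) (cellOf : Y → Δ) {Pk : ℕ}
    (hpack : ∀ a : Y, ∃ S : Finset Δ, S.card ≤ Pk ∧ ∀ z, d a z ≤ Rr → cellOf z ∈ S)
    (hdiam : ∀ b, ∀ z ∈ E b, ∀ z' ∈ E b, d z z' ≤ D) (thr : Ω → List Y)
    (hthr : ∀ ω, ∀ z ∈ Dω ω, ∃ p ∈ thr ω, d z p ≤ Df) (cr : Ω → ℝ) (hcr : ∀ ω, 3 * listLen d (thr ω) + 2 * Df ≤ cr ω)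
    (hL : ∀ b, WRS (κ + κ₁ * (Pk / r)) d (L b) C_L)
    (hK₁ : ∀ k, ∑ ω, ∑ l, ‖(Q * G ω * P) k l‖ * d k l
      * Real.exp ((κ + κ₁ * (Pk / r)) * d k l + κ₁ * (Pk / r) * cr ω) ≤ K₁)
    (hΦ : ∀ k, ∑ ω, ∑ l, (∑ b, if ω ∈ near b then (0 : ℝ) else |h b l|) * ‖(Q * G ω * P) k l‖
      * Real.exp ((κ + κ₁ * (Pk / r)) * d k l + κ₁ * (Pk / r) * cr ω) ≤ Φ)
    (hρX : C_L * (2 * N / M * (X * K₁) + X * Φ) < 1)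
    (τ : Δ → ℂ) (hτ : ∀ δ, ‖τ δ‖ ≤ Real.exp κ₁) (Δ₀ : Δ) :
    RowData κ d (Real.exp κ₁)
      (recombTerm (decPieces G DG τ Δ₀)
        (sandTerm P Q (decFamilyΩ cellOf E Dω h (pieceK Q P G x) near L τ Δ₀)) x)
      (recombMaj (pieceMaj κ₁ G DG)
        (sandMaj P Q (decMajΩ (Real.exp (κ₁ * Pk)) (κ₁ * (Pk / r)) d cr h (pieceK Q P G x) near L)) X)
      (ρG + X * (ρG * (cP * (Real.exp (κ₁ * Pk) * (N * C_L) * (1 - C_L * (2 * N / M * (X * K₁) + X * Φ))⁻¹ * cQ)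
        * ρG))) := by
  have hf0 : ∀ (ω : Ω) (l : Y) (b : B), 0 ≤ (if ω ∈ near b then (0 : ℝ) else |h b l|) := fun ω l b => by
    split_ifs
    · exact le_rfl
    · exact abs_nonneg _
  have hΩ := rowData_decFamilyΩ hw hsymm (pieceK Q P G x) Dω (pieceK_dom hKdom x) near h E L hsupp habs hM hLip hN
    hC hκ₁ hr hRD hRf cellOf hpack hdiam thr hthr cr hcr hL (budgetK₁_scale hx hw.nonneg hK₁)
    (budgetΦ_scale hx hf0 hΦ) hρX τ hτ Δ₀
  exact rowData_resolvent (rowData_decPieces G DG hG τ hτ Δ₀) hΩ hP hQ hw (Real.exp_pos κ₁) hx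

/-- **END, THEOREM B — the (2.16)-shape bound that (T1) consumes**, for the recombined G₃(x)-family, x-UNIFORM on
`‖x‖ ≤ X` and VOLUME-FREE, at every point of the disc `‖σ‖ < e^{κ₁}` (same hypotheses; `RowData.wrs_termSum_sub` =
an4's `wrs_termSum_sub` ∘ `B13PerturbativeStep.WRS.sub_apply_zero_of_differentiableOn` BY NAME).
[cite: Balaban1988RG2Cluster, (2.16)–(2.17) p.16] -/
theorem wrs_resolventΩ_sub [Nonempty Y] (hw : WeightHyp κ d) (hsymm : ∀ a b, d a b = d b a)
    (G : Ω → Matrix Y Y ℂ) (DG : Ω → Finset Δ) {κ₁ ρG : ℝ} (hκ₁ : 0 ≤ κ₁)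
    (hG : ∀ i, ∑ j, (∑ ω, pieceMaj κ₁ G DG ω i j) * Real.exp (κ * d i j) ≤ ρG)
    (P Q : Matrix Y Y ℂ) {cP cQ : ℝ} (hP : WRS κ d P cP) (hQ : WRS κ d Q cQ) {x : ℂ} {X : ℝ} (hx : ‖x‖ ≤ X)
    (Dω : Ω → Finset Y) (hKdom : ∀ ω k l, (Q * G ω * P) k l ≠ 0 → k ∈ Dω ω) (near : B → Finset Ω)
    (h : B → Y → ℝ) (E : B → Finset Y) (L : B → Matrix Y Y ℂ) (hsupp : ∀ b y, y ∉ E b → h b y = 0)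
    (habs : ∀ b y, |h b y| ≤ 1) {M N C_L K₁ Φ r D Df Rr : ℝ} (hM : 0 < M)
    (hLip : ∀ b y y', |h b y - h b y'| ≤ d y y' / M) (hN : ∀ y, ((Finset.univ.filter fun b => y ∈ E b).card : ℝ) ≤ N)
    (hC : 0 ≤ C_L) (hr : 0 < r) (hRD : r + D ≤ Rr) (hRf : r + Df ≤ Rr) (cellOf : Y → Δ) {Pk : ℕ}
    (hpack : ∀ a : Y, ∃ S : Finset Δ, S.card ≤ Pk ∧ ∀ z, d a z ≤ Rr → cellOf z ∈ S)
    (hdiam : ∀ b, ∀ z ∈ E b, ∀ z' ∈ E b, d z z' ≤ D) (thr : Ω → List Y)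
    (hthr : ∀ ω, ∀ z ∈ Dω ω, ∃ p ∈ thr ω, d z p ≤ Df) (cr : Ω → ℝ) (hcr : ∀ ω, 3 * listLen d (thr ω) + 2 * Df ≤ cr ω)
    (hL : ∀ b, WRS (κ + κ₁ * (Pk / r)) d (L b) C_L)
    (hK₁ : ∀ k, ∑ ω, ∑ l, ‖(Q * G ω * P) k l‖ * d k l
      * Real.exp ((κ + κ₁ * (Pk / r)) * d k l + κ₁ * (Pk / r) * cr ω) ≤ K₁)
    (hΦ : ∀ k, ∑ ω, ∑ l, (∑ b, if ω ∈ near b then (0 : ℝ) else |h b l|) * ‖(Q * G ω * P) k l‖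
      * Real.exp ((κ + κ₁ * (Pk / r)) * d k l + κ₁ * (Pk / r) * cr ω) ≤ Φ)
    (hρX : C_L * (2 * N / M * (X * K₁) + X * Φ) < 1)
    (τ : Δ → ℂ) (hτ : ∀ δ, ‖τ δ‖ ≤ Real.exp κ₁) (Δ₀ : Δ) {σ : ℂ} (hσ : σ ∈ ball (0 : ℂ) (Real.exp κ₁)) :
    WRS κ d
      (termSum (recombTerm (decPieces G DG τ Δ₀)
          (sandTerm P Q (decFamilyΩ cellOf E Dω h (pieceK Q P G x) near L τ Δ₀)) x) σ
        - termSum (recombTerm (decPieces G DG τ Δ₀)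
          (sandTerm P Q (decFamilyΩ cellOf E Dω h (pieceK Q P G x) near L τ Δ₀)) x) 0)
      (2 * (ρG + X * (ρG * (cP * (Real.exp (κ₁ * Pk) * (N * C_L)
        * (1 - C_L * (2 * N / M * (X * K₁) + X * Φ))⁻¹ * cQ) * ρG))) / Real.exp κ₁ * ‖σ‖) :=
  (rowData_resolventΩ hw hsymm G DG hκ₁ hG P Q hP hQ hx Dω hKdom near h E L hsupp habs hM hLip hN hC hr hRD hRf
    cellOf hpack hdiam thr hthr cr hcr hL hK₁ hΦ hρX τ hτ Δ₀).wrs_termSum_sub (Real.exp_pos κ₁) hσ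

/-- **IDENTIFICATION AT `s ≡ 1`, THEOREM B**: with moreover `x ≠ 0`, `κ₁ > 0` (so `σ = 1` is in the disc), `Σ_ω G_ω`
invertible, credits nonnegative (`0 ≤ Df`), and the co-owner's resummation data for the level-`x` near kernels
(`Σ_b h_b² = 1`, `P_bL_b = L_b`, `P_b(1 + K^{(x)}_{near b})P_b·L_b = P_b`), the recombined family at `τ ≡ 1`, `σ = 1` SUMS
to `((Σ_ωG_ω)⁻¹ + P(x·1)Q)⁻¹` — the G̃₃(x) = (G₂⁻¹ + xQ̂*Q̂)⁻¹ shape: `resummation_identity₂` + `wrs_Rem₂_le` (no separate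
`hRem`) + `termSum_decFamilyΩ_one` + `woodbury_resolvent` BY NAME. [cite: Balaban1988RG2Cluster, p.13 after (2.7)] -/
theorem termSum_resolventΩ_one [Nonempty Y] (hw : WeightHyp κ d) (hsymm : ∀ a b, d a b = d b a)
    (G : Ω → Matrix Y Y ℂ) (DG : Ω → Finset Δ) {κ₁ ρG : ℝ} (hκ₁ : 0 < κ₁)
    (hG : ∀ i, ∑ j, (∑ ω, pieceMaj κ₁ G DG ω i j) * Real.exp (κ * d i j) ≤ ρG)
    (P Q : Matrix Y Y ℂ) {cP cQ : ℝ} (hP : WRS κ d P cP) (hQ : WRS κ d Q cQ) {x : ℂ} {X : ℝ} (hx : ‖x‖ ≤ X)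
    (hx0 : x ≠ 0) (hGu : IsUnit (Ktot G))
    (Dω : Ω → Finset Y) (hKdom : ∀ ω k l, (Q * G ω * P) k l ≠ 0 → k ∈ Dω ω) (near : B → Finset Ω)
    (h : B → Y → ℝ) (E : B → Finset Y) (L : B → Matrix Y Y ℂ) (hsupp : ∀ b y, y ∉ E b → h b y = 0)
    (habs : ∀ b y, |h b y| ≤ 1) (hsum2 : ∀ y, ∑ b, h b y ^ 2 = 1) (hPL : ∀ b, Pj E b * L b = L b)
    (hloc : ∀ b, Pj E b * (1 + Knear (pieceK Q P G x) near b) * Pj E b * L b = Pj E b)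
    {M N C_L K₁ Φ r D Df Rr : ℝ} (hM : 0 < M)
    (hLip : ∀ b y y', |h b y - h b y'| ≤ d y y' / M) (hN : ∀ y, ((Finset.univ.filter fun b => y ∈ E b).card : ℝ) ≤ N)
    (hC : 0 ≤ C_L) (hr : 0 < r) (hRD : r + D ≤ Rr) (hRf : r + Df ≤ Rr) (hDf : 0 ≤ Df) (cellOf : Y → Δ) {Pk : ℕ}
    (hpack : ∀ a : Y, ∃ S : Finset Δ, S.card ≤ Pk ∧ ∀ z, d a z ≤ Rr → cellOf z ∈ S)
    (hdiam : ∀ b, ∀ z ∈ E b, ∀ z' ∈ E b, d z z' ≤ D) (thr : Ω → List Y)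
    (hthr : ∀ ω, ∀ z ∈ Dω ω, ∃ p ∈ thr ω, d z p ≤ Df) (cr : Ω → ℝ) (hcr : ∀ ω, 3 * listLen d (thr ω) + 2 * Df ≤ cr ω)
    (hL : ∀ b, WRS (κ + κ₁ * (Pk / r)) d (L b) C_L)
    (hK₁ : ∀ k, ∑ ω, ∑ l, ‖(Q * G ω * P) k l‖ * d k l
      * Real.exp ((κ + κ₁ * (Pk / r)) * d k l + κ₁ * (Pk / r) * cr ω) ≤ K₁)
    (hΦ : ∀ k, ∑ ω, ∑ l, (∑ b, if ω ∈ near b then (0 : ℝ) else |h b l|) * ‖(Q * G ω * P) k l‖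
      * Real.exp ((κ + κ₁ * (Pk / r)) * d k l + κ₁ * (Pk / r) * cr ω) ≤ Φ)
    (hρX : C_L * (2 * N / M * (X * K₁) + X * Φ) < 1) (Δ₀ : Δ) :
    termSum (recombTerm (decPieces G DG (fun _ => (1 : ℂ)) Δ₀)
        (sandTerm P Q (decFamilyΩ cellOf E Dω h (pieceK Q P G x) near L (fun _ => (1 : ℂ)) Δ₀)) x) 1
      = ((Ktot G)⁻¹ + P * (x • (1 : Matrix Y Y ℂ)) * Q)⁻¹ := by
  have hf0 : ∀ (ω : Ω) (l : Y) (b : B), 0 ≤ (if ω ∈ near b then (0 : ℝ) else |h b l|) := fun ω l b => by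
    split_ifs
    · exact le_rfl
    · exact abs_nonneg _
  have hτ : ∀ δ : Δ, ‖(fun _ => (1 : ℂ)) δ‖ ≤ Real.exp κ₁ := fun _ => by
    rw [norm_one]
    exact Real.one_le_exp hκ₁.le
  have h1 : (1 : ℂ) ∈ ball (0 : ℂ) (Real.exp κ₁) := by
    rw [mem_ball_zero_iff, norm_one]
    exact Real.one_lt_exp_iff.2 hκ₁
  have hδ : 0 ≤ κ₁ * (Pk / r) := mul_nonneg hκ₁.le (div_nonneg (Nat.cast_nonneg Pk) hr.le)
  have hcr0 : ∀ ω, 0 ≤ cr ω := fun ω =>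
    le_trans (add_nonneg (mul_nonneg (by norm_num) (listLen_nonneg d hw.nonneg (thr ω)))
      (mul_nonneg (by norm_num) hDf)) (hcr ω)
  -- the two halves' row data
  have hGr := rowData_decPieces G DG hG (fun _ => (1 : ℂ)) hτ Δ₀ (κ := κ) (d := d)
  have hΩ := rowData_decFamilyΩ hw hsymm (pieceK Q P G x) Dω (pieceK_dom hKdom x) near h E L hsupp habs hM hLip hN
    hC hκ₁.le hr hRD hRf cellOf hpack hdiam thr hthr cr hcr hL (budgetK₁_scale hx hw.nonneg hK₁)
    (budgetΦ_scale hx hf0 hΦ) hρX (fun _ => (1 : ℂ)) hτ Δ₀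
  -- the co-owner's resummation identity and the remainder smallness (§3), then their identification at s ≡ 1
  have hid := resummation_identity₂ (pieceK Q P G x) near h E L hsum2 hsupp hPL hloc
  have hRem := wrs_Rem₂_le hw hδ cr hcr0 (pieceK Q P G x) near h E L hsupp habs hM hLip hN hC hL
    (budgetK₁_scale hx hw.nonneg hK₁) (budgetΦ_scale hx hf0 hΦ)
  have hΩ1 := termSum_decFamilyΩ_one hw hid hRem hρX cellOf E Dω Δ₀ hΩ h1
  have hKu : IsUnit (1 + x • (Q * Ktot G * P)) := by
    rw [← Ktot_pieceK]
    exact (inv_one_add_eq' hw hid hRem hρX).1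
  have hG1 : termSum (decPieces G DG (fun _ => (1 : ℂ)) Δ₀) 1 = Ktot G := termSum_decPieces_one G DG Δ₀
  rw [← hG1] at hGu hKu
  rw [Ktot_pieceK, ← hG1] at hΩ1
  rw [← hG1]
  exact (woodbury_resolvent hGr hΩ hP hQ hw (Real.exp_pos κ₁) hx0 h1 hGu hKu hΩ1).symm

end TheoremB

/-! ## §2 Joint satisfiability of THEOREM B's hypotheses -/

namespace Witness

/-- One site, trivial pseudo-metric. [folklore] -/
def d₀ : Unit → Unit → ℝ := fun _ _ => 0

/-- One piece `G = 1`. [folklore] -/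
def G₁ : Unit → Matrix Unit Unit ℂ := fun _ => 1

/-- One block, partition function `h ≡ 1`. [folklore] -/
def h₁ : Unit → Unit → ℝ := fun _ _ => 1

/-- The local inverse of `P(1 + K_near)P = 1 + 1 = 2` on the block: `L = ½·1`. [folklore] -/
def L₁ : Unit → Matrix Unit Unit ℂ := fun _ => (2 : ℂ)⁻¹ • 1

/-- The weight hypothesis of the one-site model. [folklore] -/
theorem hw₀ : WeightHyp (0 : ℝ) d₀ :=
  ⟨le_rfl, fun _ => rfl, fun _ _ => le_rfl, fun _ _ _ => by simp [d₀]⟩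

/-- The RECOMBINED FAMILY of THEOREM B on the one-site data at `x = 1`, frozen decoration `τ ≡ 1`, free cell `()`. [folklore] -/
def fam : RIdx Unit (WalkΩ Unit Unit) → ℂ → Matrix Unit Unit ℂ :=
  recombTerm (decPieces G₁ (fun _ => (∅ : Finset Unit)) (fun _ => (1 : ℂ)) ())
    (sandTerm 1 1 (decFamilyΩ (fun _ => ()) (fun _ => Finset.univ) (fun _ => Finset.univ) h₁ (pieceK 1 1 G₁ 1)
      (fun _ => Finset.univ) L₁ (fun _ => (1 : ℂ)) ())) 1

/-- **`rowData_resolventΩ`'s hypotheses are jointly satisfiable**: on the one-site data (`κ = 0`, `d ≡ 0`, `κ₁ = 1`,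
`ρ_G = 1`, `P = Q = 1` with `c_P = c_Q = 1`, `x = X = 1`, `Dω = near = E = univ`, `M = N = 1`, `C_L = ½`, `K₁ = Φ = 0`,
`r = Rr = 1`, `D = Df = 0`, `Pk = 1`, thread `[()]`, credit `0`) EVERY hypothesis is discharged and the theorem yields row
data for `fam`. [folklore] -/
theorem rowData_inhabited : ∃ m ρ, RowData (0 : ℝ) d₀ (Real.exp 1) fam m ρ := by
  refine ⟨_, _, rowData_resolventΩ (B := Unit) hw₀ (fun _ _ => rfl) G₁ (fun _ => (∅ : Finset Unit)) (κ₁ := 1)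
    (ρG := 1) zero_le_one ?_ 1 1 (cP := 1) (cQ := 1) (B13PerturbativeStep.WRS.one hw₀)
    (B13PerturbativeStep.WRS.one hw₀) (x := 1) (X := 1) (by simp) (fun _ => Finset.univ)
    (fun _ _ _ _ => Finset.mem_univ _) (fun _ => Finset.univ) h₁ (fun _ => Finset.univ) L₁
    (fun _ _ hy => (hy (Finset.mem_univ _)).elim) (fun _ _ => by simp [h₁]) (M := 1) (N := 1) (C_L := 1 / 2)
    (K₁ := 0) (Φ := 0) (r := 1) (D := 0) (Df := 0) (Rr := 1) one_pos (fun _ _ _ => by simp [h₁, d₀])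
    (fun _ => by simp) (by norm_num) one_pos (by norm_num) (by norm_num) (fun _ => ()) (Pk := 1)
    (fun _ => ⟨Finset.univ, by simp, fun _ _ => Finset.mem_univ _⟩) (fun _ _ _ _ _ => le_rfl) (fun _ => [()])
    (fun _ z _ => ⟨(), by simp, le_rfl⟩) (fun _ => 0) (fun _ => by simp [listLen]) (fun _ i => ?_)
    (fun _ => by simp [d₀]) (fun _ => by simp) (by norm_num) (fun _ => (1 : ℂ))
    (fun _ => by rw [norm_one]; exact Real.one_le_exp zero_le_one) ()⟩
  · -- (T3): `Σ_j (Σ_ω e^{1·#∅}‖1‖)·e^{0} = 1 ≤ 1`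
    intro i
    simp [pieceMaj, G₁, d₀]
  · -- the local-inverse budget: `wrs (L b) i = ‖½‖ ≤ ½`
    simp [wrs, L₁, d₀]

/-- **`termSum_resolventΩ_one`'s hypotheses are jointly satisfiable** on the same data, and it identifies the sum of `fam`
at `σ = 1` with `((Σ_ωG_ω)⁻¹ + P(x·1)Q)⁻¹ = (1 + 1)⁻¹`. [folklore] -/
theorem termSum_one_inhabited : termSum fam 1 = ((Ktot G₁)⁻¹ + 1 * ((1 : ℂ) • (1 : Matrix Unit Unit ℂ)) * 1)⁻¹ := by
  refine termSum_resolventΩ_one (B := Unit) hw₀ (fun _ _ => rfl) G₁ (fun _ => (∅ : Finset Unit)) (κ₁ := 1)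
    (ρG := 1) one_pos ?_ 1 1 (cP := 1) (cQ := 1) (B13PerturbativeStep.WRS.one hw₀)
    (B13PerturbativeStep.WRS.one hw₀) (x := 1) (X := 1) (by simp) one_ne_zero ?_ (fun _ => Finset.univ)
    (fun _ _ _ _ => Finset.mem_univ _) (fun _ => Finset.univ) h₁ (fun _ => Finset.univ) L₁
    (fun _ _ hy => (hy (Finset.mem_univ _)).elim) (fun _ _ => by simp [h₁]) (fun _ => by simp [h₁]) (fun _ => ?_)
    (fun _ => ?_) (M := 1) (N := 1) (C_L := 1 / 2)
    (K₁ := 0) (Φ := 0) (r := 1) (D := 0) (Df := 0) (Rr := 1) one_pos (fun _ _ _ => by simp [h₁, d₀])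
    (fun _ => by simp) (by norm_num) one_pos (by norm_num) (by norm_num) le_rfl (fun _ => ()) (Pk := 1)
    (fun _ => ⟨Finset.univ, by simp, fun _ _ => Finset.mem_univ _⟩) (fun _ _ _ _ _ => le_rfl) (fun _ => [()])
    (fun _ z _ => ⟨(), by simp, le_rfl⟩) (fun _ => 0) (fun _ => by simp [listLen]) (fun _ i => ?_)
    (fun _ => by simp [d₀]) (fun _ => by simp) (by norm_num) ()
  · intro i
    simp [pieceMaj, G₁, d₀]
  · -- `Σ_ω G_ω = 1` is invertible
    have : Ktot G₁ = 1 := by simp [Ktot, G₁]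
    rw [this]
    exact isUnit_one
  · -- `P_b L_b = L_b` (`P_b = 1` on the full block)
    have : Pj (fun _ : Unit => (Finset.univ : Finset Unit)) () = 1 := by
      ext i j
      simp [Pj]
    rw [this, Matrix.one_mul]
  · -- the near local-inverse property: `1·(1 + 1)·1·(½·1) = 1`
    have hP : Pj (fun _ : Unit => (Finset.univ : Finset Unit)) () = 1 := by
      ext i j
      simp [Pj]
    have hK : Knear (pieceK 1 1 G₁ 1) (fun _ : Unit => (Finset.univ : Finset Unit)) () = 1 := by
      simp [Knear, pieceK, G₁]
    rw [hP, hK, Matrix.one_mul, Matrix.mul_one, L₁, Matrix.mul_smul, Matrix.mul_one]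
    ext i j
    simp [Matrix.add_apply]
    norm_num
  · simp [wrs, L₁, d₀]

end Witness

end

end Summit.QuantumFields.BalabanUV.Beta.AnalyticWalkSum216RowResolventOmega
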